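/- Width seat `ym-line-cbag-p1-w2` (prover-ym-line-cbag-p1-w2-g15-0; own items stmt-QuantumFields-22254 / 22893 CLOSED) on the
planner-of-record's LINE 4, route `U1DipoleHelicity`, crux `WilsonU1DipoleLawD4` (stmt-QuantumFields-25880): what the tree's Fröhlich–Spencer
renormalisation/Jensen machinery (the PROVED Villain perimeter law) gives for the flux-gas factors of the two-plaquette identity — a
VOLUME-UNIFORM POSITIVE LOWER BOUND, with a β-independent constant; documenting, as a theorem, why that machinery does not reach
stub 1.  Helper `--supports stmt-QuantumFields-25880`; no stub is closed here.  Nothing in this file bears on the Yang–Mills mass gap. -/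
import Summits.QuantumFields.YangMills.Theorems.U1DipoleHelicityVillainPlaqCorrDuality
import Literature.MathematicalPhysics.QuantumFieldTheory.VillainPerimeterLaw
import Literature.MathematicalPhysics.QuantumFieldTheory.VillainCoulombGas
import Literature.MathematicalPhysics.QuantumFieldTheory.VillainSpinWaveKernelBounds
import HarnessLib

/-!
# Crux `WilsonU1DipoleLawD4` (stmt-QuantumFields-25880): the flux-gas factors are uniformly positive (and why that is not enough)

In `V = ½e^{−(E_p+E_q)/2βV}(e^{B/βV}A⁻ − e^{−B/βV}A⁺)` (`villainPlaqCorr_eq_spinWave_gas`) the gas factors are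
`A^∓ = A(δ_p ∓ δ_q) = gasNum β (δ_p∓δ_q) / gasDen β` (`VillainCoulombGas.gasRatio_eq_dualRatio`).  The tree's proof of the Villain
perimeter law (`VillainPerimeterLaw.gasRatio_ge`: Jensen in Fröhlich–Spencer's renormalised ensembles) bounds every such ratio BELOW by
`exp(−(c_J·E(S) + C₀))` for `β ≥ β_J`, uniformly in the cube; with `E(δ_p ∓ δ_q) ≤ ‖δ_p ∓ δ_q‖² ≤ 4`:

* **`exp_neg_le_gasAverage_single_sub_single`**, **`exp_neg_le_gasAverage_single_add_single`**:
  `e^{−(4c_J + C₀)} ≤ A(δ_p ∓ δ_q)` for all cubes `B_n` (`n ≥ 1`), all plaquettes `p, q`, all `β ≥ β_J`.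

So `A^∓ ∈ [e^{−(4c_J+C₀)}, 1]` uniformly — a sandwich with a β-INDEPENDENT, `z`-independent floor.  This is exactly the "Jensen sandwich"
of the sizing note: it neither tends to `1` as `β → ∞` nor decays in `z`, hence cannot produce the `(C/βV)(1+|z|₁)⁻⁵` error of stub 1.
RECORD-type material on an abelian comparison line; the Yang–Mills mass gap is NOT proved by anything here.
-/

set_option autoImplicit false

noncomputable section

namespace Summit.QuantumFields.YangMills.Theorems.U1DipoleHelicity

open Finset
open scoped Real Matrix
open Literature.Probability.LatticeModels Literature.MathematicalPhysics.QuantumFieldTheory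
open Literature.MathematicalPhysics.QuantumFieldTheory.VillainAngle
open Literature.Probability.LatticeModels.GaussianCoord (gram perpPart exactEnergy)

/-- `‖δ_p − δ_q‖² ≤ 4` and `‖δ_p + δ_q‖² ≤ 4` on any finite index type: `Σ_r (δ_p(r) ∓ δ_q(r))² ≤ 2Σδ_p² + 2Σδ_q² = 4`. [folklore] -/
theorem dotProduct_self_single_pm_single_le {ι : Type*} [Fintype ι] [DecidableEq ι] (p q : ι) (s : ℝ) (hs : s = 1 ∨ s = -1) :
    ((Pi.single p (1 : ℝ) : ι → ℝ) + s • Pi.single q 1) ⬝ᵥ ((Pi.single p (1 : ℝ) : ι → ℝ) + s • Pi.single q 1) ≤ 4 := by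
  have hs2 : s ^ 2 = 1 := by rcases hs with rfl | rfl <;> norm_num
  set w : ι → ℝ := (Pi.single p (1 : ℝ) : ι → ℝ) + s • Pi.single q 1 with hw
  have hwr : ∀ r, w r = (Pi.single p (1 : ℝ) : ι → ℝ) r + s * (Pi.single q (1 : ℝ) : ι → ℝ) r := fun r => by
    simp only [hw, Pi.add_apply, Pi.smul_apply, smul_eq_mul]
  have hpt : ∀ r, w r * w r ≤ 2 * (Pi.single p (1 : ℝ) : ι → ℝ) r ^ 2 + 2 * (Pi.single q (1 : ℝ) : ι → ℝ) r ^ 2 := by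
    intro r
    rw [hwr]
    nlinarith [sq_nonneg ((Pi.single p (1 : ℝ) : ι → ℝ) r - s * (Pi.single q (1 : ℝ) : ι → ℝ) r), hs2,
      sq_nonneg ((Pi.single q (1 : ℝ) : ι → ℝ) r)]
  have hsq : ∀ r' : ι, ∑ r, (Pi.single r' (1 : ℝ) : ι → ℝ) r ^ 2 = 1 := fun r' => by
    rw [Finset.sum_eq_single r' (fun r _ hr => by rw [Pi.single_eq_of_ne hr]; ring)
      (fun h => absurd (Finset.mem_univ r') h), Pi.single_eq_same, one_pow]
  calc w ⬝ᵥ w = ∑ r, w r * w r := rfl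
    _ ≤ ∑ r, (2 * (Pi.single p (1 : ℝ) : ι → ℝ) r ^ 2 + 2 * (Pi.single q (1 : ℝ) : ι → ℝ) r ^ 2) := Finset.sum_le_sum fun r _ => hpt r
    _ = 4 := by rw [Finset.sum_add_distrib, ← Finset.mul_sum, ← Finset.mul_sum, hsq p, hsq q]; norm_num

/-- The spin-wave energy of `δ_p ∓ δ_q` is at most `4`. [folklore] -/
theorem exactEnergy_single_pm_single_le_four {n : ℕ} (p q : PIdx 4 n) (s : ℝ) (hs : s = 1 ∨ s = -1) :
    exactEnergy dMat ((Pi.single p (1 : ℝ) : PIdx 4 n → ℝ) + s • Pi.single q 1) ≤ 4 :=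
  (exactEnergy_le_dotProduct_self dMat posDef_gram_dMat _).trans (dotProduct_self_single_pm_single_le p q s hs)

/-- The real cast of `δ_p − δ_q` (integer) is `δ_p + (−1)•δ_q` (real). [folklore] -/
theorem intCast_single_sub_single_eq {n : ℕ} (p q : PIdx 4 n) :
    (fun r => ((Pi.single p (1 : ℤ) - Pi.single q 1 : PIdx 4 n → ℤ) r : ℝ)) =
      (Pi.single p (1 : ℝ) : PIdx 4 n → ℝ) + (-1 : ℝ) • Pi.single q 1 := by
  funext r
  simp only [Pi.sub_apply, Pi.add_apply, Pi.smul_apply, Int.cast_sub, smul_eq_mul, neg_one_mul, ← sub_eq_add_neg]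
  by_cases hp : r = p <;> by_cases hq : r = q <;> subst_vars <;> simp_all

/-- The real cast of `δ_p + δ_q` (integer) is `δ_p + 1•δ_q` (real). [folklore] -/
theorem intCast_single_add_single_eq {n : ℕ} (p q : PIdx 4 n) :
    (fun r => ((Pi.single p (1 : ℤ) + Pi.single q 1 : PIdx 4 n → ℤ) r : ℝ)) =
      (Pi.single p (1 : ℝ) : PIdx 4 n → ℝ) + (1 : ℝ) • Pi.single q 1 := by
  funext r
  simp only [Pi.add_apply, Pi.smul_apply, Int.cast_add, smul_eq_mul, one_mul]
  by_cases hp : r = p <;> by_cases hq : r = q <;> subst_vars <;> simp_all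

/-- **Uniform positivity of the gas factor `A⁻ = A(δ_p − δ_q)`** (FS82 renormalisation + Jensen, as PROVED for the perimeter law):
`e^{−(4c_J + C₀)} ≤ (∑_ξ g(ξ)cos⟨ξ_⊥, δ_p−δ_q⟩)/(∑_ξ g(ξ))` for every cube `B_n`, `n ≥ 1`, all `p, q`, all `β ≥ β_J`.  The floor is
β-independent and `z`-independent: a sandwich, not a dipole law. [cite: FrohlichSpencerCMP1982, §2.6–§2.9 (2.74)–(2.87)] -/
theorem exp_neg_le_gasAverage_single_sub_single {n : ℕ} (hn : 1 ≤ n) {β : ℝ} (hβ : betaJ ≤ β) (p q : PIdx 4 n) :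
    Real.exp (-(4 * cJ + C0)) ≤
      (∑' ξ : (PIdx 4 n → ℤ) ⧸ (VillainFibre.dFree (d := 4) (n := n)).range,
          coulombWeight β ξ * Real.cos (perpPart dMat (fluxRep ξ) ⬝ᵥ fun r =>
            ((Pi.single p (1 : ℤ) - Pi.single q 1 : PIdx 4 n → ℤ) r : ℝ))) /
        ∑' ξ : (PIdx 4 n → ℤ) ⧸ (VillainFibre.dFree (d := 4) (n := n)).range, coulombWeight β ξ := by
  have hβpos : 0 < β := betaJ_pos.trans_le hβ
  have h := gasRatio_ge hn hβ (Pi.single p (1 : ℤ) - Pi.single q 1)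
  rw [gasRatio_eq_dualRatio hβpos, epsField_dotProduct_self] at h
  refine le_trans (Real.exp_le_exp.2 ?_) h
  have hE : exactEnergy dMat (fun r => ((Pi.single p (1 : ℤ) - Pi.single q 1 : PIdx 4 n → ℤ) r : ℝ)) ≤ 4 := by
    rw [intCast_single_sub_single_eq]
    exact exactEnergy_single_pm_single_le_four p q (-1) (Or.inr rfl)
  nlinarith [cJ_nonneg, hE]

/-- **Uniform positivity of the gas factor `A⁺ = A(δ_p + δ_q)`**: `e^{−(4c_J + C₀)} ≤ (∑_ξ g(ξ)cos⟨ξ_⊥, δ_p+δ_q⟩)/(∑_ξ g(ξ))` for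
every cube, all `p, q`, all `β ≥ β_J`. [cite: FrohlichSpencerCMP1982, §2.6–§2.9 (2.74)–(2.87)] -/
theorem exp_neg_le_gasAverage_single_add_single {n : ℕ} (hn : 1 ≤ n) {β : ℝ} (hβ : betaJ ≤ β) (p q : PIdx 4 n) :
    Real.exp (-(4 * cJ + C0)) ≤
      (∑' ξ : (PIdx 4 n → ℤ) ⧸ (VillainFibre.dFree (d := 4) (n := n)).range,
          coulombWeight β ξ * Real.cos (perpPart dMat (fluxRep ξ) ⬝ᵥ fun r =>
            ((Pi.single p (1 : ℤ) + Pi.single q 1 : PIdx 4 n → ℤ) r : ℝ))) /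
        ∑' ξ : (PIdx 4 n → ℤ) ⧸ (VillainFibre.dFree (d := 4) (n := n)).range, coulombWeight β ξ := by
  have hβpos : 0 < β := betaJ_pos.trans_le hβ
  have h := gasRatio_ge hn hβ (Pi.single p (1 : ℤ) + Pi.single q 1)
  rw [gasRatio_eq_dualRatio hβpos, epsField_dotProduct_self] at h
  refine le_trans (Real.exp_le_exp.2 ?_) h
  have hE : exactEnergy dMat (fun r => ((Pi.single p (1 : ℤ) + Pi.single q 1 : PIdx 4 n → ℤ) r : ℝ)) ≤ 4 := by
    rw [intCast_single_add_single_eq]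
    exact exactEnergy_single_pm_single_le_four p q 1 (Or.inl rfl)
  nlinarith [cJ_nonneg, hE]

end Summit.QuantumFields.YangMills.Theorems.U1DipoleHelicity

end
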